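import Summits.CriticalPhenomena.PercolationContinuityZ3.Theorems.PercNearOneGluingNoHeavyQuantHoeffdingMixture
import Summits.CriticalPhenomena.PercolationContinuityZ3.Theorems.PercNearOneGluingNoHeavyQuantHeavyShift
import HarnessLib

/-!
# QUANT lane R8, T-DEC: HOEFFDING'S THREE-VALUE REDUCTION, part 3 — conjecture BLOB-AFL for ARBITRARY gate vectors at width `n` follows
# from the family "`r` equal blobs at gate `g`, floor `S/n`, target `k·(r·g − m)`", `m + r ≤ n` (prim-quant-census-2 gen 83, file 3/3)

builds on p205010 (kernel theorem, internal audit signed; external expert review pending)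

Support file (`--supports stmt-CriticalPhenomena-4575`), QUANT lane census seat prim-quant-census-2 (gen 83); memo
`run/shared/lean/prim/quant/prim-quant-census-2-g83/HOEFFDING-G83.md`.  Theorems only, standard axioms, no sorries, no definitions.

Conjecture BLOB-AFL (TRIPLE-G80.md §5; kernel so far: every gate vector up to width 4, every width for `Σg ≤ 2` or `min g ≥ 1/2`, equal gates
through width 8): `n` blobs of a common size `k` with gates `G` are HEAVY at floor `ΣG/n` (the average gate) and target `k·ΣG`.  Heavy
decompositions are convex in the law, so the three-value mixture `blobLaw_threeValued_mixture` (file 2/3) reduces the conjecture for an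
ARBITRARY gate vector of width `n` and sum `S` to the three-valued vectors `(1^m, g^r, 0^z)`, `m + r + z = n`, `m + r·g = S`, at the SAME floor
`S/n` and target `k·S`; the zeros do not change the law, the `m` ones shift the law of the `r` equal blobs by `m·k` (`heavy_shift_full`: target
lowered by `2·m·k`), and when `m ≥ r·g` there is no low atom at all:
* `heavy_mono`, `heavy_points`, **`heavy_of_mixture`** — heavy decompositions (the inline `∃` of `decAtT_of_heavy`) are monotone in floor and
  top, trivial for laws charging only atoms `h` with `2h ≥ T`, and stable under finite mixtures.
* **`heavy_blobLaw_of_threeValued`** — BLOB-AFL for `G` from BLOB-AFL-type heaviness of the three-valued lists of the same width and sum.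
* `blobLaw_cons_zero_gate`, `blobLaw_cons_one_gate`, `blobLaw_append_congr`, `blobLaw_replicate_zero`, `blobLaw_ones_append`,
  `perm_replicate_of_threeValued`, `blobLaw_onesEqual_eq` (normal form `P_{(1^m, g^r)}(h) = P_{Bin(r,g)}(h − m·k)·[m·k ≤ h]`),
  `blobLaw_append_zeros_eq`, `heavy_onesEqual_of_shifted` (shifted form ⟹ list form, by `heavy_shift_full`).
* **`heavy_blobLaw_of_onesEqualFamily`** — THE REDUCTION: if for all `m + r ≤ |G|`, `g ∈ (0,1)` with `m + r·g = ΣG` and `m < r·g` the law of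
  the gate list `(1^m, g^r)` is heavy at floor `ΣG/|G|` and target `k·ΣG` on `{0..(m+r)·k}`, then `blobLaw (G.map (k,·))` is heavy at
  `(ΣG/|G|, k·ΣG)` on `{0..|G|·k}`; **`heavy_blobLaw_of_binomialFamily`** — the same with the hypothesis in SHIFTED form: the law of `r` equal
  blobs `(k, g)` heavy at floor `ΣG/|G|` and LOWERED target `k·(r·g − m)` on `{0..r·k}`.  For a fixed width `n` this is a list of `(m, r)`
  cells, each ONE real-parameter family (`g = (S − m)/r`); `m = 0` is the equal-gates case (kernel through width 8); cells with `g ≥ 1/2`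
  are reflection cells (all gates of `(1^m, g^r)` are `≥ 1/2`).  E.g. width 5, arbitrary gates, needs beyond the equal-gates theorems and
  reflection exactly the single-low cells `(m, r) = (1,4)`, `g ∈ (1/4, 1/2)` and `(1,3)`, `g ∈ (1/3, 1/2)`.

HONEST STATUS.  Reduction only; conjecture BLOB-AFL in the middle band beyond width 4, conjecture C, `SiblingStep`, `FarTreeRow`, `GluedLemmaW`,
`GluedDominatedMass` OPEN; RATE class (log\*) / honest sentence of `run/shared/lean/prim/quant/README.md` unchanged.  [this work].  The
three-value phenomenon is classical [cite: Hoeffding1956, Theorem 5]; it is NOT used as a cited fact.  The gluing rows served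
[cite: KozmaNitzan2024, Conjecture 3 (p. 15)]; product measure [cite: Grimmett1999, §1.3 p. 10].
-/

noncomputable section

open scoped BigOperators

namespace Summit.CriticalPhenomena.PercolationContinuityZ3.Theorems
namespace Quant

open Finset

/-- the two-point law `{lo, hi; g}` (as in `…QuantLawDEC`) -/
local notation3 "TP[" lo ", " hi ", " g ", " h "]" =>
  (g : ℝ) * (if (h : ℕ) = (hi : ℕ) then (1 : ℝ) else 0) + (1 - (g : ℝ)) * (if (h : ℕ) = (lo : ℕ) then (1 : ℝ) else 0)

/-- a HEAVY decomposition of the law `μ` on `{0..M}` at floor `x`, target `T` (the inline `∃` consumed by `decAtT_of_heavy`) -/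
local notation3 "HEAVY[" x ", " T ", " M ", " μ "]" =>
  ∃ (ι : Type) (_ : Fintype ι) (lam γ : ι → ℝ) (lo hi : ι → ℕ),
    (∀ i, 0 ≤ lam i) ∧ (∑ i, lam i = 1) ∧ (∀ i, 0 ≤ γ i ∧ γ i ≤ 1) ∧ (∀ i, lo i ≤ hi i) ∧ (∀ i, hi i ≤ (M : ℕ)) ∧
    (∀ h, (μ : ℕ → ℝ) h = ∑ i, lam i * TP[lo i, hi i, γ i, h]) ∧
    (∀ i, 0 < lam i → (x : ℝ) ≤ γ i ∧ (T : ℝ) ≤ 2 * (lo i : ℝ) + ((hi i : ℝ) - lo i) * γ i)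

/-- the blob list of a gate list at the common blob size `k` -/
local notation3 "BL[" k ", " G "]" => LawDec.blobLaw (List.map (fun g : ℝ => ((k : ℕ), g)) G)

namespace LawDec

/-! ### 1. Heavy decompositions: monotone, trivial for point laws, stable under mixtures -/

/-- a heavy decomposition at floor `x` on `{0..M}` is one at any lower floor `x'` on any larger range `{0..M'}`. [this work] -/
theorem heavy_mono (x x' T : ℝ) (M M' : ℕ) (μ : ℕ → ℝ) (hx : x' ≤ x) (hM : M ≤ M') (hH : HEAVY[x, T, M, μ]) :
    HEAVY[x', T, M', μ] := by
  obtain ⟨ι, hι, lam, γ, lo, hi, h0, h1, hγ, hlohi, hhi, hμ, hval⟩ := hH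
  exact ⟨ι, hι, lam, γ, lo, hi, h0, h1, hγ, hlohi, fun i => (hhi i).trans hM, hμ,
    fun i hi0 => ⟨hx.trans (hval i hi0).1, (hval i hi0).2⟩⟩

/-- **POINT LAWS.**  A law on `{0..M}` (vanishing above `M`, mass `1`) all of whose charged atoms `h` have `2h ≥ T` is heavy at every floor
`x ≤ 1`: every atom is a self-sufficient point (gate `1`). [this work] -/
theorem heavy_points (x T : ℝ) (M : ℕ) (μ : ℕ → ℝ) (hx : x ≤ 1) (hμ0 : ∀ h, 0 ≤ μ h) (hμM : ∀ h, M < h → μ h = 0)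
    (hμ1 : ∑ h ∈ Finset.range (M + 1), μ h = 1) (hT : ∀ h, 0 < μ h → T ≤ 2 * (h : ℝ)) : HEAVY[x, T, M, μ] := by
  classical
  refine ⟨Fin (M + 1), inferInstance, fun i => μ i, fun _ => 1, fun i => i, fun i => i, fun i => hμ0 i, ?_,
    fun _ => ⟨zero_le_one, le_rfl⟩, fun _ => le_rfl, fun i => Nat.lt_succ_iff.1 i.2, fun h => ?_, fun i hi0 => ⟨hx, ?_⟩⟩
  · rw [Fin.sum_univ_eq_sum_range (fun i => μ i) (M + 1), hμ1]
  · by_cases hh : h ≤ M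
    · rw [Fin.sum_univ_eq_sum_range (fun i : ℕ => μ i * ((1 : ℝ) * (if h = i then (1 : ℝ) else 0)
          + (1 - 1) * (if h = i then (1 : ℝ) else 0))) (M + 1)]
      rw [Finset.sum_eq_single h]
      · simp
      · intro b _ hb
        rw [if_neg (Ne.symm hb)]; ring
      · intro hm
        exact absurd (Finset.mem_range.2 (Nat.lt_succ_of_le hh)) hm
    · rw [hμM h (not_le.1 hh)]
      symm
      refine Finset.sum_eq_zero fun i _ => ?_
      have : h ≠ (i : ℕ) := fun e => hh (e ▸ Nat.lt_succ_iff.1 i.2)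
      rw [if_neg this]; ring
  · have := hT i hi0
    push_cast
    linarith

/-- **MIXTURES.**  A finite mixture `μ = Σ_c w_c·ν_c` (convex weights) of laws each heavy at `(x, T)` on `{0..M}` is heavy at `(x, T)` on
`{0..M}` (index the components by the pairs `(c, i)`). [this work] -/
theorem heavy_of_mixture {κ : Type} [Fintype κ] (x T : ℝ) (M : ℕ) (w : κ → ℝ) (ν : κ → ℕ → ℝ) (μ : ℕ → ℝ)
    (hw0 : ∀ c, 0 ≤ w c) (hw1 : ∑ c, w c = 1) (hν : ∀ c, HEAVY[x, T, M, ν c]) (hμ : ∀ h, μ h = ∑ c, w c * ν c h) :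
    HEAVY[x, T, M, μ] := by
  classical
  choose ι hι lam γ lo hi h0 h1 hγ hlohi hhi hlaw hval using hν
  letI : ∀ c, Fintype (ι c) := hι
  refine ⟨(Σ c, ι c), inferInstance, fun p => w p.1 * lam p.1 p.2, fun p => γ p.1 p.2, fun p => lo p.1 p.2, fun p => hi p.1 p.2,
    fun p => mul_nonneg (hw0 _) (h0 _ _), ?_, fun p => hγ _ _, fun p => hlohi _ _, fun p => hhi _ _, fun h => ?_, ?_⟩
  · rw [Fintype.sum_sigma]
    simp_rw [← Finset.mul_sum, h1, mul_one]
    exact hw1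
  · rw [hμ h, Fintype.sum_sigma]
    refine Finset.sum_congr rfl fun c _ => ?_
    rw [hlaw c h, Finset.mul_sum]
    refine Finset.sum_congr rfl fun i _ => ?_
    ring
  · rintro ⟨c, i⟩ hp
    have hli : 0 < lam c i := lt_of_le_of_ne (h0 c i) fun e => by
      simp only at hp; rw [← e, mul_zero] at hp; exact lt_irrefl _ hp
    exact hval c i hli
/-! ### 2. BLOB-AFL for arbitrary gates from the three-valued lists -/

/-- **BLOB-AFL FROM THE THREE-VALUED LISTS.**  If every three-valued gate list `F ⊂ {0, g, 1}` with the width and the gate sum of `G` has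
`blobLaw (F.map (k,·))` heavy at floor `ΣG/|G|` and target `k·ΣG` on `{0..|G|·k}`, then so has `G`. [this work] -/
theorem heavy_blobLaw_of_threeValued (k : ℕ) (G : List ℝ) (hG : ∀ g ∈ G, 0 ≤ g ∧ g ≤ 1)
    (H : ∀ F : List ℝ, F.length = G.length → F.sum = G.sum → (∀ x ∈ F, 0 ≤ x ∧ x ≤ 1) →
      (∃ g : ℝ, 0 < g ∧ g < 1 ∧ ∀ x ∈ F, x = 0 ∨ x = 1 ∨ x = g) →
      HEAVY[G.sum / G.length, (k : ℝ) * G.sum, G.length * k, BL[k, F]]) :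
    HEAVY[G.sum / G.length, (k : ℝ) * G.sum, G.length * k, BL[k, G]] := by
  obtain ⟨ι, hι, lam, F, h0, h1, hF, hlaw⟩ := blobLaw_threeValued_mixture G hG
  exact heavy_of_mixture _ _ _ lam (fun i => BL[k, F i]) _ h0 h1
    (fun i => H (F i) (hF i).1 (hF i).2.1 (hF i).2.2.1 (hF i).2.2.2) (fun h => hlaw k h)

/-- a blob at gate `0` does not change the law. [this work] -/
theorem blobLaw_cons_zero_gate (k : ℕ) (l : List (ℕ × ℝ)) : blobLaw ((k, (0 : ℝ)) :: l) = blobLaw l := by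
  funext h; simp [blobLaw, slice]

/-- a blob of size `k` at gate `1` shifts the law by `k`. [this work] -/
theorem blobLaw_cons_one_gate (k : ℕ) (l : List (ℕ × ℝ)) (h : ℕ) :
    blobLaw ((k, (1 : ℝ)) :: l) h = if k ≤ h then blobLaw l (h - k) else 0 := by
  simp [blobLaw, slice]

/-- the law of `l₁ ++ l₂` depends on `l₂` only through its law. [this work] -/
theorem blobLaw_append_congr (l₁ l₂ l₂' : List (ℕ × ℝ)) (h : blobLaw l₂ = blobLaw l₂') :
    blobLaw (l₁ ++ l₂) = blobLaw (l₁ ++ l₂') := by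
  induction l₁ with
  | nil => simpa using h
  | cons p l ih => simp only [List.cons_append, blobLaw, ih]

/-- blobs at gate `0` have the law of no blobs. [this work] -/
theorem blobLaw_replicate_zero (k z : ℕ) : blobLaw (List.replicate z (k, (0 : ℝ))) = blobLaw [] := by
  induction z with
  | zero => rfl
  | succ z ih => rw [List.replicate_succ, blobLaw_cons_zero_gate, ih]

/-- `m` blobs of size `k` at gate `1` in front of `l` shift the law of `l` by `m·k`. [this work] -/
theorem blobLaw_ones_append (k : ℕ) (l : List (ℕ × ℝ)) : ∀ (m h : ℕ),
    blobLaw (List.replicate m (k, (1 : ℝ)) ++ l) h = if m * k ≤ h then blobLaw l (h - m * k) else 0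
  | 0, h => by simp
  | m + 1, h => by
    rw [List.replicate_succ, List.cons_append, blobLaw_cons_one_gate, Nat.succ_mul]
    by_cases hk : k ≤ h
    · rw [if_pos hk, blobLaw_ones_append k l m (h - k)]
      by_cases hm : m * k ≤ h - k
      · rw [if_pos hm, if_pos (by omega), Nat.sub_sub, Nat.add_comm]
      · rw [if_neg hm, if_neg (by omega)]
    · rw [if_neg hk, if_neg (by omega)]

/-- a three-valued list is a permutation of `ones ++ g's ++ zeros`. [this work] -/
theorem perm_replicate_of_threeValued (g : ℝ) : ∀ F : List ℝ, (∀ x ∈ F, x = 0 ∨ x = 1 ∨ x = g) →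
    ∃ m r z : ℕ, m + r + z = F.length ∧ F.Perm (List.replicate m 1 ++ List.replicate r g ++ List.replicate z 0)
  | [], _ => ⟨0, 0, 0, rfl, by simp⟩
  | x :: F, hF => by
    obtain ⟨m, r, z, hlen, hperm⟩ :=
      perm_replicate_of_threeValued g F fun y hy => hF y (List.mem_cons_of_mem x hy)
    rcases hF x List.mem_cons_self with hx | hx | hx
    · refine ⟨m, r, z + 1, by rw [List.length_cons, ← hlen]; ring, ?_⟩
      rw [hx, List.replicate_succ]
      exact (hperm.cons 0).trans List.perm_middle.symm
    · refine ⟨m + 1, r, z, by rw [List.length_cons, ← hlen]; ring, ?_⟩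
      rw [hx, List.replicate_succ, List.cons_append, List.cons_append]
      exact hperm.cons 1
    · refine ⟨m, r + 1, z, by rw [List.length_cons, ← hlen]; ring, ?_⟩
      rw [hx, List.replicate_succ]
      refine (hperm.cons g).trans ?_
      simp only [List.append_assoc, List.cons_append]
      exact List.perm_middle.symm

/-- **NORMAL FORM.**  The law of `m` ones and `r` gates `g` (blob size `k`): `P(h) = P_{Bin(r,g)}(h − m·k)·[m·k ≤ h]`. [this work] -/
theorem blobLaw_onesEqual_eq (k m r : ℕ) (g : ℝ) (h : ℕ) :
    BL[k, List.replicate m 1 ++ List.replicate r g] h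
      = if m * k ≤ h then blobLaw (List.replicate r (k, g)) (h - m * k) else 0 := by
  simp only [List.map_append, List.map_replicate]
  exact blobLaw_ones_append k _ m h

/-- zeros appended to a gate list do not change the law. [this work] -/
theorem blobLaw_append_zeros_eq (k z : ℕ) (G : List ℝ) : BL[k, G ++ List.replicate z 0] = BL[k, G] := by
  simp only [List.map_append, List.map_replicate]
  rw [blobLaw_append_congr _ _ [] (blobLaw_replicate_zero k z), List.append_nil]

/-- **FROM THE SHIFTED FORM.**  If the law of `r` equal blobs `(k, g)` is heavy at floor `x` and LOWERED target `k·(r·g − m)` on `{0..r·k}`,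
then the law of `m` ones and `r` gates `g` is heavy at floor `x` and target `k·(m + r·g)` on `{0..(m+r)·k}` (`heavy_shift_full`). [this work] -/
theorem heavy_onesEqual_of_shifted (k m r : ℕ) (g x : ℝ)
    (hH : HEAVY[x, (k : ℝ) * (r * g - m), r * k, blobLaw (List.replicate r (k, g))]) :
    HEAVY[x, (k : ℝ) * (m + r * g), (m + r) * k, BL[k, List.replicate m 1 ++ List.replicate r g]] := by
  obtain ⟨ι, hι, lam, γ, lo, hi, h0, h1, hγ, hlohi, hhi, hμ, hcr⟩ :=
    heavy_shift_full x ((k : ℝ) * (r * g - m)) (r * k) (m * k) _ hH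
  have hT : (k : ℝ) * (r * g - m) + 2 * ((m * k : ℕ) : ℝ) = (k : ℝ) * (m + r * g) := by push_cast; ring
  have hM : r * k + m * k = (m + r) * k := by ring
  refine ⟨ι, hι, lam, γ, lo, hi, h0, h1, hγ, hlohi, fun i => (hhi i).trans hM.le, fun h => ?_,
    fun i hi0 => ⟨(hcr i hi0).1, hT ▸ (hcr i hi0).2⟩⟩
  rw [blobLaw_onesEqual_eq]; exact hμ h

/-- **THE REDUCTION OF BLOB-AFL TO ONES + EQUAL GATES.**  Let `G ⊂ [0,1]` be any gate list (`n = |G|`, `S = ΣG`).  Suppose that for all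
`m + r ≤ n` and `g ∈ (0,1)` with `m + r·g = S` and `m < r·g`, the law of the gate list `(1^m, g^r)` (blob size `k`) is heavy at floor `S/n` and
target `k·S` on `{0..(m+r)·k}`.  Then `blobLaw (G.map (k,·))` is heavy at floor `S/n` (the AVERAGE gate) and target `k·S` on `{0..n·k}` —
conjecture BLOB-AFL for `G`.  (Three-value mixture; zeros are invisible; when `m ≥ r·g` every charged atom `h ≥ m·k` has `2h ≥ k·S`.) [this work] -/
theorem heavy_blobLaw_of_onesEqualFamily (k : ℕ) (G : List ℝ) (hG : ∀ g ∈ G, 0 ≤ g ∧ g ≤ 1)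
    (H : ∀ (m r : ℕ) (g : ℝ), m + r ≤ G.length → 0 < g → g < 1 → (m : ℝ) + r * g = G.sum → (m : ℝ) < r * g →
      HEAVY[G.sum / G.length, (k : ℝ) * G.sum, (m + r) * k, BL[k, List.replicate m 1 ++ List.replicate r g]]) :
    HEAVY[G.sum / G.length, (k : ℝ) * G.sum, G.length * k, BL[k, G]] := by
  apply heavy_blobLaw_of_threeValued k G hG
  intro F hlen hsum hF01 hF
  obtain ⟨g, hg0, hg1, hval⟩ := hF
  obtain ⟨m, r, z, hmrz, hperm⟩ := perm_replicate_of_threeValued g F hval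
  have hlawF : BL[k, F] = BL[k, List.replicate m 1 ++ List.replicate r g] := by
    rw [blobLaw_perm (hperm.map (fun x : ℝ => (k, x)))]
    exact blobLaw_append_zeros_eq k z _
  have hFsum : F.sum = m + r * g := by
    rw [hperm.sum_eq]; simp only [List.sum_append, List.sum_replicate, nsmul_eq_mul, mul_one, mul_zero, add_zero]
  -- the floor is at most `1`
  have hx1 : G.sum / G.length ≤ 1 := by
    have hle : G.sum ≤ (G.length : ℝ) * 1 := sum_le_length_mul 1 G fun x hx => (hG x hx).2
    rcases (Nat.cast_nonneg G.length : (0 : ℝ) ≤ G.length).eq_or_lt with h0 | hpos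
    · rw [← h0, div_zero]; exact zero_le_one
    · rw [div_le_one hpos]; linarith
  by_cases hlow : (m : ℝ) < r * g
  · have hH := H m r g (by omega) hg0 hg1 (by rw [← hsum, hFsum]) hlow
    rw [hlawF]
    exact heavy_mono _ _ _ _ _ _ le_rfl (by rw [← hlen, ← hmrz]; exact Nat.mul_le_mul_right k (by omega)) hH
  · -- no low atom: every charged atom `h` has `h ≥ m·k` and `k·S = k(m + r g) ≤ 2 m k ≤ 2h`
    have htop : blobTop (List.map (fun x : ℝ => (k, x)) F) = G.length * k := by rw [blobTop_blobs, hlen]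
    refine heavy_points _ _ _ _ hx1 (blobLaw_nonneg _ (blobs_gates_mem k F hF01))
      (fun h hh => blobLaw_eq_zero _ h (by rw [htop]; exact hh)) (by rw [← htop]; exact sum_blobLaw _) fun h hh => ?_
    rw [hlawF, blobLaw_onesEqual_eq] at hh
    by_cases hmk : m * k ≤ h
    · have hmk' : ((m : ℝ) * k) ≤ h := by exact_mod_cast hmk
      have hk0 : (0 : ℝ) ≤ k := Nat.cast_nonneg k
      have hrg : (r : ℝ) * g ≤ m := not_lt.1 hlow
      rw [← hsum, hFsum]
      nlinarith
    · rw [if_neg hmk] at hh; exact absurd hh (lt_irrefl 0)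

/-- **THE SAME, SHIFTED FORM** (binomial family with lowered targets): it suffices that for all `m + r ≤ n`, `g ∈ (0,1)` with
`m + r·g = S`, `m < r·g`, the law of `r` equal blobs `(k, g)` is heavy at floor `S/n` and target `k·(r·g − m)` on `{0..r·k}`.  For a fixed
width this is a list of `(m, r)` cells, each a ONE-parameter family; `m = 0` is the equal-gates case (kernel through width 8). [this work] -/
theorem heavy_blobLaw_of_binomialFamily (k : ℕ) (G : List ℝ) (hG : ∀ g ∈ G, 0 ≤ g ∧ g ≤ 1)
    (H : ∀ (m r : ℕ) (g : ℝ), m + r ≤ G.length → 0 < g → g < 1 → (m : ℝ) + r * g = G.sum → (m : ℝ) < r * g →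
      HEAVY[G.sum / G.length, (k : ℝ) * (r * g - m), r * k, blobLaw (List.replicate r (k, g))]) :
    HEAVY[G.sum / G.length, (k : ℝ) * G.sum, G.length * k, BL[k, G]] := by
  refine heavy_blobLaw_of_onesEqualFamily k G hG fun m r g hmr hg0 hg1 hS hlow => ?_
  have key := heavy_onesEqual_of_shifted k m r g _ (H m r g hmr hg0 hg1 hS hlow)
  rw [hS] at key
  exact key

end LawDec
end Quant
end Summit.CriticalPhenomena.PercolationContinuityZ3.Theorems
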